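import Literature.MathematicalPhysics.QuantumFieldTheory.Balaban1983to89.T4TermwiseOscillation

/-!
# T4TermwiseChainSU2 — the term-wise (U)(L) producers for G = SU(2) Wilson terms PLUGGED INTO the good-class ledger

HONEST FRAMING (T4-DAG page 1, repeated on purpose). This file is bookkeeping on a FIXED FINITE four-torus at rung
(B)+1 of the cell's ladder: it concerns existence/uniqueness of the `ε → 0` limit of unit-scale block-averaged
expectations in finite volume, CONDITIONALLY. It is NOT infinite volume, NOT a mass gap, NOT the Clay statement, and
NOT a proof of the spine estimate NE7 (matching of the two runs' constants with `Σ_K δ_K < ∞`). NE7 is NOT PRINTED in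
[Balaban1983]–[Balaban1989LargeFieldII] (one run at fixed `ε`, bounds uniform in `ε`; no two-run comparison) and is NOT
proved here. No sentence of print is quoted in this file; nothing printed is asserted. ABSOLUTE RULE honoured: every
hypothesis below is a NAMED binder of the theorem; none is minted as a fact, none is hidden in a definition.

## What this leaf does (generation 12 of lineage t4-ne7-p1, fifth leaf; technique: TERM-WISE matching)
Generation 9's `T4TermwiseClassical.goodClause_summable_of_kindsRA_lift` delivers the GOOD-CLASS half of the hybrid
matching with an explicit `δ⁗_K` and `Summable δ⁗` from the ledger kinds, taking the one-step classical errors (U)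
`hUdev hdU0 hdU` and (L) `hLdev hdL0 hdL` as hypotheses. Generation 10 (`T4TermwiseQuartic`) re-expressed those six
binders through the REGULARITY of one step ((wt)(ker)(cnt)(repr)(tr)(bch)(sz)(osc)(scal)), and generation 12
instantiated that regularity for G = SU(2) WILSON TERMS on Bałaban's concrete objects of [Balaban1985Averaging]
(block average (14)–(15), axial gauge (9)/p. 24, transcribed in `B7Prop1Explicit`; NOT quoted here):
`T4TermwiseTorus` ((ker)(cnt) on the torus), `T4TermwiseSU2` ((tr)(wt), quaternion pull-back), `T4TermwiseInstantiate`
((bch)(sz)(scal), one call per scale), `T4TermwiseOscillation` ((osc-U) from the plaquette-level input (44∇)). The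
capstone `T4TermwiseOscillation.interpolation_averaging_SU2_osc` OUTPUTS exactly the six (U)(L) binders with the
explicit geometric majorants `dU4`, `dL4` below and `vol = M⁴`.

THIS FILE is the one remaining `exact`: `goodClause_summable_SU2` = generation 9's theorem with (U)(L) SUPPLIED by the
SU(2) capstone. Its hypotheses are, BY NAME and verbatim from the two theorems it composes:
* the LEDGER KINDS of generation 9 (unchanged, all hypotheses, none discharged here): composed E-rate `hUR` (a
  HYPOTHESIS; in the cell's DAG the composed rate is the business of the upstream nodes NE2–NE5, whose own conditionals
  — BetaPertH, (B), (B^μ) — are theirs and are neither discharged nor restated here), boundary family `hURB`, 𝐑-family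
  `hURR`, format (F) `hfmtA hfmtB hint hoff`, (S) `hS hSle`, multiplicities (M)(M-B)(M-R) `hM hMB hMR`, witness (F′) `hwit`, (B-adm)(B-win) `hpend hBwin`, (N)
  `hnpos hzA hzB hzAs hzBs`, (Q) `hq`, (R-sc)(R-S) `hrsc hRSA hRSB`, the flow window (0.31) of BOTH coupling tables
  `h031A h031B` (the flow window (0.31) in the discrete form `Step.Discrete031`, exactly as in generations 8–10; an
  INPUT),
  (min-A)(Q)(lift)(min-B)(act) `hminA hQ hlift hminB hact hw₀`, (γ) `hγ hrγ`, (R-w) `hwpos hRw hRRw hrw`, (W-w) `hWw hsw`;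
* the SU(2) TERM-WISE INPUTS of generation 12 (all hypotheses): (repr) `hreprU hreprL` (the weight-free actions ARE the
  Wilson plaquette sums of the named configurations — definitional in print, a hypothesis because `f₁ g Q` are
  abstract); the per-scale BACKGROUND AXIOMS `hA hB` ((44): SU(2)-valued, `M·L^{K+1}`-periodic bond variables with
  `‖V(∂p) − 1‖ ≤ α₀(K)` — the small-field condition, an INPUT) and `hAosc` ((44∇): forward-bond covariant
  nearest-neighbour oscillation of the plaquette logarithm `≤ α₁(K)`, run A — an INPUT, NOT PRINTED as used); the
  smallness `hαK` (`20480·L²·α₀(K) ≤ 1`); the DECAY LAWS `hdecay` (`α₀(K) ≤ c_α ε₁ L^{−2K}`, (B)-type INPUT) and `hα₁K`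
  (`0 ≤ α₁(K) ≤ c_{α1} ε₁ L^{−2(K+1)} L^{−K}`, (B∇)-type INPUT), `hcα hε₁`; `2 ≤ M`, `2 ≤ L`, genuine planes `hplanes`;
* ONE new comparison hypothesis `hMvol : (M : ℝ)⁴ ≤ vol` (the ledger's volume parameter dominates the number `M⁴` of
  unit blocks of the torus; with `vol = M⁴` it is `le_rfl`).
OUTPUT: `GoodClause l₀ vol T A B Bad δ⁗ ∧ Summable δ⁗` with generation 9's `δ⁗` in which the action-kind share is
`w₀·(dU4 L #planes c_α c_{α1} ε₁ K + dL4 L #planes c_α ε₁ K)` — term-wise rates composed along the tower, summable by the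
geometric factor `(L⁻²)^K` (`2 ≤ L`). Nothing else changes; no ledger kind is weakened or strengthened.

## What is NOT delivered
Any discharge of a ledger kind; any derivation of (44)/(44∇) or of their decay laws from print (they are the shape of
the series' inductive small-field hypotheses — whether a DERIVATIVE bound of strength `ε₁L^{−3K−2}` is among them is
the literature seats' question, not asserted); (repr) for non-Wilson terms; SU(N), N ≥ 3; the bad-class half (node U5b/c,
other lineages); infinite volume; anything at rung (B)+2 or above.

## Register
Everything here is [folklore] plumbing (one `obtain` + one `exact` + two abbreviating definitions). Loci named for
orientation only: [Balaban1985Averaging] (the averaging operation and axial gauge, via `B7Prop1Explicit`),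
[Balaban1987RG1] ((0.31), as located by generations 8–10 upstream, via `Step.Discrete031`). No quotation.
-/

noncomputable section

open Finset MeasureTheory _root_.Filter _root_.Topology
open scoped BigOperators RealInnerProductSpace Quaternion Matrix.Norms.L2Operator

namespace Literature.MathematicalPhysics.QuantumFieldTheory.Balaban1983to89.T4TermwiseChainSU2

open T4OutputRate T4RecentScale T4GoodClassBudget T4CauchySum T4Crossover T4TowerRateComposition T4TowerRateDischarge
open T4BoundaryCarrier (BFunctional atFl NE9Fl LipBackgroundFl NE5B)
open T4TermwiseBudget T4TermwiseDeviation T4TermwiseCurrency T4TermwiseBoundary T4TermwiseResidual T4TermwiseAction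
open T4TermwiseClassical T4TermwiseQuartic T4TermwiseInstantiate T4TermwiseOscillation
open B7Prop1Explicit B7Prop2Explicit B7Prop2SpecialUnitary T4TermwiseBCH T4TermwiseTorus T4TermwiseSU2

/-! ## §1 The explicit geometric majorants of (U) and (L) for SU(2) Wilson terms -/

/-- The (U)-majorant per unit block delivered by `interpolation_averaging_SU2_osc`:
`dU4 L n c_α c_{α1} ε₁ K = n·(cOSC² ε₁²/4 + cSZ·cBCH·ε₁³ + (1/24)(cSZ ε₁ + cBCH ε₁²)⁴)·(L⁻²)^K`
(`n` = number of plaquette planes carried; `cOSC = 16L c_{α1}`, `cSZ = 2L²c_α`, `cBCH = 280(320L²c_α)²`). [folklore] -/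
def dU4 (L n : ℕ) (cα cα₁ ε₁ : ℝ) (K : ℕ) : ℝ :=
  (n : ℝ) * (cOSC L cα₁ ^ 2 * ε₁ ^ 2 / 4 + cSZ L cα * cBCH L cα * ε₁ ^ 3
    + 1 / 24 * (cSZ L cα * ε₁ + cBCH L cα * ε₁ ^ 2) ^ 4) * (((L : ℝ) ^ 2)⁻¹) ^ K

/-- The (L)-majorant per unit block delivered by `interpolation_averaging_SU2_osc`:
`dL4 L n c_α ε₁ K = n·(cSZ·cBCH·ε₁³ + cBCH² ε₁⁴/2 + (1/24) cSZ⁴ ε₁⁴)·(L⁻²)^K`. [folklore] -/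
def dL4 (L n : ℕ) (cα ε₁ : ℝ) (K : ℕ) : ℝ :=
  (n : ℝ) * (cSZ L cα * cBCH L cα * ε₁ ^ 3 + cBCH L cα ^ 2 * ε₁ ^ 4 / 2
    + 1 / 24 * (cSZ L cα ^ 4 * ε₁ ^ 4)) * (((L : ℝ) ^ 2)⁻¹) ^ K

/-- Unfolding lemma for `dU4`. [folklore] -/
theorem dU4_def (L n : ℕ) (cα cα₁ ε₁ : ℝ) (K : ℕ) :
    dU4 L n cα cα₁ ε₁ K = (n : ℝ) * (cOSC L cα₁ ^ 2 * ε₁ ^ 2 / 4 + cSZ L cα * cBCH L cα * ε₁ ^ 3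
      + 1 / 24 * (cSZ L cα * ε₁ + cBCH L cα * ε₁ ^ 2) ^ 4) * (((L : ℝ) ^ 2)⁻¹) ^ K := rfl

/-- Unfolding lemma for `dL4`. [folklore] -/
theorem dL4_def (L n : ℕ) (cα ε₁ : ℝ) (K : ℕ) :
    dL4 L n cα ε₁ K = (n : ℝ) * (cSZ L cα * cBCH L cα * ε₁ ^ 3 + cBCH L cα ^ 2 * ε₁ ^ 4 / 2
      + 1 / 24 * (cSZ L cα ^ 4 * ε₁ ^ 4)) * (((L : ℝ) ^ 2)⁻¹) ^ K := rfl

/-! ## §2 The good-class half with `Summable δ⁗` for G = SU(2) Wilson terms -/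

section Ledger

variable {C : T4BoundaryCarrier.Carriers} {ι : Type} [MeasurableSpace ι] {σ : Type*} [DecidableEq σ] {l₀ vol : ℝ}
  {T : ℕ → Finset σ} {Bad : ℕ → ℝ → Finset σ} {A B : ℕ → ℝ → σ → ℝ} {μ : ℕ → ℝ → σ → Measure ι}
  {fac bfac rfac : ℕ → ℝ → σ → Finset C.Dom} {Adm : Set ι} {EA : Functional C.toCarriers C.BgA}
  {EB : Functional C.toCarriers C.BgB} {BA : BFunctional C C.BgA} {BB : BFunctional C C.BgB}
  {RA : Functional C.toCarriers C.BgA} {RB : Functional C.toCarriers C.BgB}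
  {κ θ' Cr EB₀ CrR R₁ b β' w₀ : ℝ} {κ₀ : ℕ} {gA gB : ℕ → ℕ → ℝ} {gfA gfB : ℕ → ℝ} {gsA gsB : ℕ → ℕ → ℝ}
  {uA : ℕ → ι → C.BgA} {uB : ℕ → ι → C.BgB} {oneA : C.BgA} {oneB : C.BgB}
  {pend : ℕ → ℝ → σ → ι → C.Fl} {nA nB aA aB wA wB γA γB : ℕ → ℝ → σ → ι → ℝ} {qA qB : ℕ → ℝ}
  {κ₁ S : ℕ → ℝ → σ → ℕ → ℝ} {cW RW : ℕ → ℝ → σ → ℝ} {rw sw rγ zA zB c₀ : ℕ → ℝ} {Cw E a Λ Cl : ℝ}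

/-- **THE GOOD-CLASS HALF WITH `Summable δ⁗` FOR G = SU(2) WILSON TERMS: generation 9's
`goodClause_summable_of_kindsRA_lift` with (U) `hUdev hdU0 hdU` and (L) `hLdev hdL0 hdL` SUPPLIED by
`T4TermwiseOscillation.interpolation_averaging_SU2_osc`.**  Every other ledger binder of generation 9 is carried BY
NAME and VERBATIM (none discharged); the SU(2) term-wise inputs (repr) `hreprU hreprL`, the per-scale background axioms
(44) `hA hB` and (44∇) `hAosc`, the smallness `hαK`, the decay laws `hdecay` ((B)-type INPUT) and `hα₁K` ((B∇)-type
INPUT), `hcα hε₁`, `2 ≤ M`, `2 ≤ L`, genuine planes, and `hMvol : M⁴ ≤ vol` are hypotheses.  OUTPUT: the good clause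
with generation 9's `δ⁗` whose action-kind share is `w₀·(dU4 … K + dL4 … K)`, and `Summable δ⁗`.  No print is quoted;
nothing printed is asserted; NOT NE7, NOT Clay. [folklore] -/
theorem goodClause_summable_SU2 {Y YA : Type*} {Sfib : ℕ → ℝ → σ → ι → Set Y}
    {SfibA : ℕ → ℝ → σ → ι → Set YA} {g : ℕ → ℝ → σ → ι → YA → ℝ} {f₁ : ℕ → ℝ → σ → ι → Y → ℝ}
    {Q : ℕ → ℝ → σ → ι → Y → YA} {yA yB : ℕ → ℝ → σ → ι → Y} {xA : ℕ → ℝ → σ → ι → YA}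
    (M L : ℕ) (hMtwo : 2 ≤ M) (hLtwo : 2 ≤ L) (planes : Finset (Fin 4 × Fin 4))
    (hplanes : ∀ P ∈ planes, P.1 ≠ P.2)
    (VA VB : ℕ → ℝ → σ → ι → (B7Prop1Explicit.Site 4 → Fin 4 → M₂ˣ))
    {αK α₁K : ℕ → ℝ} {cα cα₁ ε₁ : ℝ}
    (hUR : ∀ K, URateUpTo K EA EB (gA K) (gB K) (uA K) (uB K) Adm Cr θ' κ) (hCr : 0 ≤ Cr)
    (hθ'0 : 0 < θ') (hθ'1 : θ' < 1) (hθ'Λ : θ' ≤ Λ) (hΛ1 : 1 ≤ Λ) (hCl : 0 ≤ Cl)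
    (hURB : ∀ b ∈ C.admFl, ∀ K, URateUpTo K (atFl BA b) (atFl BB b) (gA K) (gB K) (uA K) (uB K) Adm EB₀ θ' κ)
    (hEB₀ : 0 ≤ EB₀)
    (hURR : ∀ K, URateUpTo K RA RB (gA K) (gB K) (uA K) (uB K) Adm CrR θ' κ) (hCrR : 0 ≤ CrR)
    (hfmtA : ∀ K t τ, A K t τ = ∫ v, (∏ X ∈ fac K t τ,
      Real.exp (EA (gA K) (uA K v) X - EA (gA K) oneA X)) *
        ((∏ X ∈ bfac K t τ, Real.exp (BA (gA K) (uA K v) (pend K t τ v) X)) * nA K t τ v * qA K *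
          ((∏ X ∈ rfac K t τ, Real.exp (RA (gA K) (uA K v) X - RA (gA K) oneA X)) * (Real.exp (-aA K t τ v) * wA K t τ v)))
          ∂(μ K t τ))
    (hfmtB : ∀ K t τ, B K t τ = ∫ v, (∏ X ∈ fac K t τ,
      Real.exp (EB (gB K) (uB K v) X - EB (gB K) oneB X)) *
        ((∏ X ∈ bfac K t τ, Real.exp (BB (gB K) (uB K v) (pend K t τ v) X)) * nB K t τ v * qB K *
          ((∏ X ∈ rfac K t τ, Real.exp (RB (gB K) (uB K v) X - RB (gB K) oneB X)) * (Real.exp (-aB K t τ v) * wB K t τ v)))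
          ∂(μ K t τ))
    (hint : ∀ K t, |t| ≤ l₀ → ∀ τ ∈ T K \ Bad K t,
      Integrable (fun v => (∏ X ∈ fac K t τ, Real.exp (EA (gA K) (uA K v) X - EA (gA K) oneA X)) *
        ((∏ X ∈ bfac K t τ, Real.exp (BA (gA K) (uA K v) (pend K t τ v) X)) * nA K t τ v * qA K *
          ((∏ X ∈ rfac K t τ, Real.exp (RA (gA K) (uA K v) X - RA (gA K) oneA X)) * (Real.exp (-aA K t τ v) * wA K t τ v))))
          (μ K t τ) ∧
      Integrable (fun v => (∏ X ∈ fac K t τ, Real.exp (EB (gB K) (uB K v) X - EB (gB K) oneB X)) *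
        ((∏ X ∈ bfac K t τ, Real.exp (BB (gB K) (uB K v) (pend K t τ v) X)) * nB K t τ v * qB K *
          ((∏ X ∈ rfac K t τ, Real.exp (RB (gB K) (uB K v) X - RB (gB K) oneB X)) * (Real.exp (-aB K t τ v) * wB K t τ v))))
          (μ K t τ))
    (hsc : ∀ K t, |t| ≤ l₀ → ∀ τ ∈ T K \ Bad K t, ∀ X ∈ fac K t τ, C.scale X ≤ K)
    (hoff : ∀ K t, |t| ≤ l₀ → ∀ τ ∈ T K \ Bad K t, ∀ v, v ∉ Adm →
      (∏ X ∈ fac K t τ, Real.exp (EA (gA K) (uA K v) X - EA (gA K) oneA X)) *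
        ((∏ X ∈ bfac K t τ, Real.exp (BA (gA K) (uA K v) (pend K t τ v) X)) * nA K t τ v * qA K *
          ((∏ X ∈ rfac K t τ, Real.exp (RA (gA K) (uA K v) X - RA (gA K) oneA X)) * (Real.exp (-aA K t τ v) * wA K t τ v)))
          = 0 ∧
      (∏ X ∈ fac K t τ, Real.exp (EB (gB K) (uB K v) X - EB (gB K) oneB X)) *
        ((∏ X ∈ bfac K t τ, Real.exp (BB (gB K) (uB K v) (pend K t τ v) X)) * nB K t τ v * qB K *
          ((∏ X ∈ rfac K t τ, Real.exp (RB (gB K) (uB K v) X - RB (gB K) oneB X)) * (Real.exp (-aB K t τ v) * wB K t τ v)))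
          = 0)
    (hS : ∀ K t, |t| ≤ l₀ → ∀ τ ∈ T K \ Bad K t, ∀ v ∈ Adm, ∀ j ≤ K,
      |(∑ X ∈ fac K t τ with C.scale X = j,
          (Real.log (Real.exp (EB (gB K) (uB K v) X - EB (gB K) oneB X))
            - Real.log (Real.exp (EA (gA K) (uA K v) X - EA (gA K) oneA X)))) - κ₁ K t τ j| ≤ S K t τ j)
    (hM : ∀ K t, |t| ≤ l₀ → ∀ τ ∈ T K \ Bad K t,
      Multiplicity (fac K t τ) C.scale (fun X => Real.exp (-(κ * C.d X))) Cw vol Λ K)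
    (hwit : ∀ K, ∃ v₁ ∈ Adm, uA K v₁ = oneA ∧ uB K v₁ = oneB)
    (hvol : 0 ≤ vol) (hE : 0 ≤ E) (ha0 : 0 < a) (ha1 : a < 1)
    (hSle : ∀ K t, |t| ≤ l₀ → ∀ τ ∈ T K \ Bad K t, ∀ j ≤ K, S K t τ j ≤ vol * (E * a ^ (K - j)))
    (hpend : ∀ K t, |t| ≤ l₀ → ∀ τ ∈ T K \ Bad K t, ∀ v ∈ Adm, pend K t τ v ∈ C.admFl)
    (hBwin : ∀ K t, |t| ≤ l₀ → ∀ τ ∈ T K \ Bad K t, RecentOnly (bfac K t τ) C.scale (jlogOf Cl K) K)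
    (hMB : ∀ K t, |t| ≤ l₀ → ∀ τ ∈ T K \ Bad K t,
      Multiplicity (bfac K t τ) C.scale (fun X => Real.exp (-(κ * C.d X))) Cw vol Λ K)
    (hnpos : ∀ K t, |t| ≤ l₀ → ∀ τ ∈ T K \ Bad K t, ∀ v ∈ Adm, 0 < nA K t τ v ∧ 0 < nB K t τ v)
    (hzA : ∀ K t, |t| ≤ l₀ → ∀ τ ∈ T K \ Bad K t, ∀ v ∈ Adm, |Real.log (nA K t τ v)| ≤ vol * zA K)
    (hzB : ∀ K t, |t| ≤ l₀ → ∀ τ ∈ T K \ Bad K t, ∀ v ∈ Adm, |Real.log (nB K t τ v)| ≤ vol * zB K)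
    (hzAs : Summable zA) (hzBs : Summable zB)
    (hq : ∀ K, 0 < qA K ∧ 0 < qB K)
    -- the 𝐑-kind: scales, multiplicity, one-run slice sizes, the flow window of both coupling tables
    (hrsc : ∀ K t, |t| ≤ l₀ → ∀ τ ∈ T K \ Bad K t, ∀ X ∈ rfac K t τ, C.scale X ≤ K)
    (hMR : ∀ K t, |t| ≤ l₀ → ∀ τ ∈ T K \ Bad K t,
      Multiplicity (rfac K t τ) C.scale (fun X => Real.exp (-(κ * C.d X))) Cw vol Λ K)
    (hRSA : ∀ K t, |t| ≤ l₀ → ∀ τ ∈ T K \ Bad K t, ∀ v ∈ Adm, ∀ j ≤ K,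
      |∑ X ∈ rfac K t τ with C.scale X = j, (RA (gA K) (uA K v) X - RA (gA K) oneA X)| ≤ vol * (R₁ * gsA K j ^ κ₀))
    (hRSB : ∀ K t, |t| ≤ l₀ → ∀ τ ∈ T K \ Bad K t, ∀ v ∈ Adm, ∀ j ≤ K,
      |∑ X ∈ rfac K t τ with C.scale X = j, (RB (gB K) (uB K v) X - RB (gB K) oneB X)| ≤ vol * (R₁ * gsB K j ^ κ₀))
    (hb : 0 < b) (h031A : ∀ K, Step.Discrete031 b β' K (gfA K) (gsA K))
    (h031B : ∀ K, Step.Discrete031 b β' K (gfB K) (gsB K)) (hgsA : ∀ K k, k ≤ K → 0 ≤ gsA K k)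
    (hgsB : ∀ K k, k ≤ K → 0 ≤ gsB K k) (hR₁ : 0 ≤ R₁) (hκ₀ : 4 < κ₀)
    -- the ACTION kind from ONE CLASSICAL STEP: (min-A) (Q) (lift) (min-B) (act) (U) (L) (γ)
    (hminA : ∀ K t, |t| ≤ l₀ → ∀ τ ∈ T K \ Bad K t, ∀ v ∈ Adm, IsMinOn (g K t τ v) (SfibA K t τ v) (xA K t τ v))
    (hQ : ∀ K t, |t| ≤ l₀ → ∀ τ ∈ T K \ Bad K t, ∀ v ∈ Adm, Set.MapsTo (Q K t τ v) (Sfib K t τ v) (SfibA K t τ v))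
    (hlift : ∀ K t, |t| ≤ l₀ → ∀ τ ∈ T K \ Bad K t, ∀ v ∈ Adm,
      yA K t τ v ∈ Sfib K t τ v ∧ Q K t τ v (yA K t τ v) = xA K t τ v)
    (hminB : ∀ K t, |t| ≤ l₀ → ∀ τ ∈ T K \ Bad K t, ∀ v ∈ Adm,
      yB K t τ v ∈ Sfib K t τ v ∧ IsMinOn (f₁ K t τ v) (Sfib K t τ v) (yB K t τ v))
    (hact : ∀ K t, |t| ≤ l₀ → ∀ τ ∈ T K \ Bad K t, ∀ v ∈ Adm,
      aA K t τ v = w₀ * g K t τ v (xA K t τ v) + γA K t τ v ∧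
        aB K t τ v = w₀ * f₁ K t τ v (yB K t τ v) + γB K t τ v)
    (hw₀ : 0 ≤ w₀)
    -- (U)(L) PRODUCED for G = SU(2) Wilson terms (`T4TermwiseOscillation.interpolation_averaging_SU2_osc`): (repr)
    -- `hreprU hreprL`, (44) `hA hB`, (44∇) `hAosc`, smallness `hαK`, decays `hdecay` `hα₁K`, `hcα hε₁`, and `M⁴ ≤ vol`
    (hαK : ∀ K, 0 ≤ αK K ∧ 20480 * (L : ℝ) ^ 2 * αK K ≤ 1)
    (hA : ∀ K t, |t| ≤ l₀ → ∀ τ ∈ T K \ Bad K t, ∀ v ∈ Adm,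
      (∀ x κ, VA K t τ v x κ ∈ specialUnitaryUnits (Fin 2)) ∧ IsPeriodic (M * L ^ K * L) (VA K t τ v) ∧
        ∀ (x : B7Prop1Explicit.Site 4) (κ κ' : Fin 4), κ ≠ κ' →
          ‖((hol (VA K t τ v) x (plaqWord κ κ') : M₂ˣ) : M₂) - 1‖ ≤ αK K)
    (hB : ∀ K t, |t| ≤ l₀ → ∀ τ ∈ T K \ Bad K t, ∀ v ∈ Adm,
      (∀ x κ, VB K t τ v x κ ∈ specialUnitaryUnits (Fin 2)) ∧ IsPeriodic (M * L ^ K * L) (VB K t τ v) ∧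
        ∀ (x : B7Prop1Explicit.Site 4) (κ κ' : Fin 4), κ ≠ κ' →
          ‖((hol (VB K t τ v) x (plaqWord κ κ') : M₂ˣ) : M₂) - 1‖ ≤ αK K)
    (hAosc : ∀ K t, |t| ≤ l₀ → ∀ τ ∈ T K \ Bad K t, ∀ v ∈ Adm, ∀ P ∈ planes,
      ∀ (z : B7Prop1Explicit.Site 4) (κ : Fin 4),
        ‖((VA K t τ v z κ : M₂ˣ) : M₂) * phiM (VA K t τ v) P (z + e κ)
            * (((VA K t τ v z κ)⁻¹ : M₂ˣ) : M₂) - phiM (VA K t τ v) P z‖ ≤ α₁K K)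
    (hcα : 0 ≤ cα) (hdecay : ∀ K, αK K ≤ cα * ε₁ * (((L : ℝ) ^ K)⁻¹) ^ 2)
    (hα₁K : ∀ K, 0 ≤ α₁K K ∧ α₁K K ≤ cα₁ * ε₁ * (((L : ℝ) ^ (K + 1))⁻¹) ^ 2 * ((L : ℝ) ^ K)⁻¹)
    (hreprU : ∀ K t, |t| ≤ l₀ → ∀ τ ∈ T K \ Bad K t, ∀ v ∈ Adm,
      f₁ K t τ v (yA K t τ v) = ∑ x ∈ pbox planes (M * L ^ K * L), eQ (phiQ (VA K t τ v) x) ∧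
        g K t τ v (xA K t τ v) = ∑ y ∈ pbox planes (M * L ^ K), eQ (psiQ L (VA K t τ v) y))
    (hreprL : ∀ K t, |t| ≤ l₀ → ∀ τ ∈ T K \ Bad K t, ∀ v ∈ Adm,
      f₁ K t τ v (yB K t τ v) = ∑ x ∈ pbox planes (M * L ^ K * L), eQ (phiQ (VB K t τ v) x) ∧
        g K t τ v (Q K t τ v (yB K t τ v)) = ∑ y ∈ pbox planes (M * L ^ K), eQ (psiQ L (VB K t τ v) y))
    (hε₁ : 0 ≤ ε₁) (hMvol : ((M : ℝ)) ^ 4 ≤ vol)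
    (hγ : ∀ K t, |t| ≤ l₀ → ∀ τ ∈ T K \ Bad K t, ∀ v ∈ Adm, |γB K t τ v - γA K t τ v| ≤ vol * rγ K)
    (hrγ : Summable rγ)
    -- the residual kind after generation 8: (R-w) radii about a centre `cW`, (W-w) the WITNESS log-ratio centred
    (hwpos : ∀ K t, |t| ≤ l₀ → ∀ τ ∈ T K \ Bad K t, ∀ v ∈ Adm, 0 < wA K t τ v ∧ 0 < wB K t τ v)
    (hRw : ∀ K t, |t| ≤ l₀ → ∀ τ ∈ T K \ Bad K t, ∀ v ∈ Adm,
      |Real.log (wB K t τ v) - Real.log (wA K t τ v) - cW K t τ| ≤ RW K t τ)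
    (hRRw : ∀ K t, |t| ≤ l₀ → ∀ τ ∈ T K \ Bad K t, RW K t τ ≤ vol * rw K) (hrw : Summable rw)
    (hWw : ∀ K t, |t| ≤ l₀ → ∀ τ ∈ T K \ Bad K t, ∀ v ∈ Adm, uA K v = oneA → uB K v = oneB →
      |Real.log (wB K t τ v) - Real.log (wA K t τ v) - c₀ K| ≤ vol * sw K)
    (hsw : Summable sw) :
    GoodClause l₀ vol T A B Bad
        (fun K => (max Cw 1 * ((E + Cr) * ∑ x ∈ antidiagonal K, min (a ^ x.2) (θ' ^ x.1 * Λ ^ x.2))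
            + (EB₀ * Cw * windowSum θ' Λ (jlogOf Cl K) K + (zA K + zB K)
              + (max (2 * Cw) 1 * ((∑ p ∈ antidiagonal K, min (R₁ * gsA K p.1 ^ κ₀) (CrR * θ' ^ p.1 * Λ ^ p.2))
                  + ∑ p ∈ antidiagonal K, min (R₁ * gsB K p.1 ^ κ₀) (CrR * θ' ^ p.1 * Λ ^ p.2))
                + (w₀ * (dU4 L planes.card cα cα₁ ε₁ K + dL4 L planes.card cα ε₁ K) + rγ K + rw K))))
          + (max Cw 1 * ((E + Cr) * ∑ x ∈ antidiagonal K, min (a ^ x.2) (θ' ^ x.1 * Λ ^ x.2)) + (rw K + sw K))) ∧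
      Summable (fun K => (max Cw 1 * ((E + Cr) * ∑ x ∈ antidiagonal K, min (a ^ x.2) (θ' ^ x.1 * Λ ^ x.2))
            + (EB₀ * Cw * windowSum θ' Λ (jlogOf Cl K) K + (zA K + zB K)
              + (max (2 * Cw) 1 * ((∑ p ∈ antidiagonal K, min (R₁ * gsA K p.1 ^ κ₀) (CrR * θ' ^ p.1 * Λ ^ p.2))
                  + ∑ p ∈ antidiagonal K, min (R₁ * gsB K p.1 ^ κ₀) (CrR * θ' ^ p.1 * Λ ^ p.2))
                + (w₀ * (dU4 L planes.card cα cα₁ ε₁ K + dL4 L planes.card cα ε₁ K) + rγ K + rw K))))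
          + (max Cw 1 * ((E + Cr) * ∑ x ∈ antidiagonal K, min (a ^ x.2) (θ' ^ x.1 * Λ ^ x.2)) + (rw K + sw K))) := by
  obtain ⟨hU, hLd, hU0, hL0, hUs, hLs⟩ := interpolation_averaging_SU2_osc (g := g) (f₁ := f₁) (Q := Q) (yA := yA)
    (yB := yB) (xA := xA) M L hMtwo hLtwo planes hplanes VA VB hαK hA hB hAosc hcα hdecay hα₁K hreprU hreprL hε₁
  have hUdev : ∀ K t, |t| ≤ l₀ → ∀ τ ∈ T K \ Bad K t, ∀ v ∈ Adm,
      f₁ K t τ v (yA K t τ v) - g K t τ v (xA K t τ v) ≤ vol * dU4 L planes.card cα cα₁ ε₁ K :=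
    fun K t ht τ hτ v hv => (hU K t ht τ hτ v hv).trans (mul_le_mul_of_nonneg_right hMvol (hU0 K))
  have hLdev : ∀ K t, |t| ≤ l₀ → ∀ τ ∈ T K \ Bad K t, ∀ v ∈ Adm,
      g K t τ v (Q K t τ v (yB K t τ v)) - f₁ K t τ v (yB K t τ v) ≤ vol * dL4 L planes.card cα ε₁ K :=
    fun K t ht τ hτ v hv => (hLd K t ht τ hτ v hv).trans (mul_le_mul_of_nonneg_right hMvol (hL0 K))
  have hdU0 : ∀ K, 0 ≤ dU4 L planes.card cα cα₁ ε₁ K := hU0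
  have hdL0 : ∀ K, 0 ≤ dL4 L planes.card cα ε₁ K := hL0
  have hdU : Summable (dU4 L planes.card cα cα₁ ε₁) := hUs
  have hdL : Summable (dL4 L planes.card cα ε₁) := hLs
  exact goodClause_summable_of_kindsRA_lift hUR hCr hθ'0 hθ'1 hθ'Λ hΛ1 hCl hURB hEB₀ hURR hCrR hfmtA hfmtB hint hsc
    hoff hS hM hwit hvol hE ha0 ha1 hSle hpend hBwin hMB hnpos hzA hzB hzAs hzBs hq hrsc hMR hRSA hRSB hb h031A h031B
    hgsA hgsB hR₁ hκ₀ hminA hQ hlift hminB hact hw₀ hUdev hLdev hdU0 hdL0 hdU hdL hγ hrγ hwpos hRw hRRw hrw hWw hsw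

end Ledger

/-! ## §3 Sanity (no physics): the majorants at a trivial parameter point -/

section Toy

/-- With `ε₁ = 0` both majorants vanish identically (the two runs coincide term-wise when there is no field):
non-vacuity of the shape, nothing more. [folklore] -/
theorem dU4_dL4_zero (L n : ℕ) (cα cα₁ : ℝ) (K : ℕ) :
    dU4 L n cα cα₁ 0 K = 0 ∧ dL4 L n cα 0 K = 0 := by
  constructor <;> simp [dU4, dL4]

/-- `hMvol` with the ledger volume chosen as the number of unit blocks: `vol = M⁴`. [folklore] -/
example (M : ℕ) : ((M : ℝ)) ^ 4 ≤ (M : ℝ) ^ 4 := le_rfl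

end Toy

end Literature.MathematicalPhysics.QuantumFieldTheory.Balaban1983to89.T4TermwiseChainSU2
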